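import Summits.HubbardSuperconductivity.HubbardSuperconductivity.Theorems.AnisotropyChordTransferFibre3KernelWindow

/-!
# Route `AnisotropyChord` / H0 rotor rung: PORT PartN35 — LEVEL-2 TOOLKIT (statements): the torus Green's function `G_λ(r)`, the exact 1D ROW FORMULAS, the HEAT-KERNEL / GEOMETRIC bound on `max_r(−G)` (LEMMA G-MIN), the L-UNIFORM elementary bracket of `S₂` (LEMMA L2-B1), the explicit `Δ(λ)`, the real-space profile formula, and the measured asymptotic constant of `G_λ(0)`

Port (verbatim modulo this header, the port comment, lint options, and ONE announced identification) of the theory seat's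
statement file `hubbard-h0-rotor-theory-1/cycle21/lean/PartN35.lean` (sha16 `e285266dfa591a47`; theory seat `hubbard-h0-rotor-theory-1`
g21, REPORT 26, memo ROTOR-THEORY-21 §309–§312, LEVEL2-SPEC.md).
THE IDENTIFICATION (PartN37 header «`gres`/`Gres` coincide with PartN35's `gsymb`/`Gfun` (same formulas); on porting, identify them»,
PORT-INDEX one-copy policy): `gsymb`/`Gfun` are NOT re-declared; the statements below are written over the tree copy `gres`/`Gres` of
`…Fibre3KernelWindow` (PORT PartN37), whose bodies are byte-identical to the dropped ones — so every statement is definitionally the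
typed one.  All `Prop` names are unchanged (including `GfunZero`).  Nothing else deviates.
Statements only (`def … : Prop` targets typed by the theory seat; the typed source proves nothing here): `GfunZero`, `S2sum`,
`ProfileFromGreen`, `DeltaExplicit`, `RingResolventSum`, `RingResolventSumTrig`, `muRow`, `alpha0`, `GRowFormula`, `HeatKernelGMin`,
`GeomGMin`, `zWindow`, `xi2lo`, `xi2hi`, `S2UniformBracket`, `I0const`, `cNu`, `GzeroAsymptotic`.
Prover seat `hubbard-h0-rotor-p2` g0; helper for stmt-HubbardSuperconductivity-19089 (`--supports`, helper class).
WHAT THIS IS NOT: nothing here proves superconductivity in the Hubbard model; the rotor TARGET as originally worded stays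
FALSE (g15 verdict) — these are helper statements of ONE conditional reduction (rung 19089: GM₃ ∀L certificate, Level-2 rows A/B).
`GzeroAsymptotic` is a MEASURED enclosure (target), not claimed proved.  Mathlib + tree imports only; no sorry, no axioms.

Theory seat's own summary of the file:

# PartN35 — LEVEL-2 TOOLKIT (statements): the torus Green's function `G_λ(r)`, the exact 1D ROW FORMULAS,
the HEAT-KERNEL / GEOMETRIC bound on `max_r(−G)` (LEMMA G-MIN), the L-UNIFORM elementary bracket of `S₂`
(LEMMA L2-B1), the explicit `Δ(λ)` and the real-space profile formula, and the measured asymptotic constant of `G_λ(0)`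
(theory seat hubbard-h0-rotor-theory-1, generation 21; memo ROTOR-THEORY-21 §309–§312, LEVEL2-SPEC.md).

Everything here is about ONE-BODY lattice sums on the `L × L` torus with the zero mode removed:
`g(k) = 1/(2ε(k) − λ)` (`k ≠ 0`), `G_λ(r) = (1/V) Σ_{k≠0} cos(k·r) g(k)`, `V = L²`, `λ = λ₂ ∈ (0, 2ε₁)`.
Numerical verification: cycle21/calc/gmin_row.py (row formulas, 1e-15), gmin_heatkernel.py (G-min bound / truth = 1.15),
level2_B1_uniform.py (S₂ bracket contains the truth for L = L₀ … 8L₀), level2_g0.py (c(ν), remainder), lib21.py (profile formula).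
`RingResolventSum`, `RingResolventSumTrig`, `HeatKernelGMin`, `GeomGMin`, `S2UniformBracket`, `DeltaExplicit`, `ProfileFromGreen`
are PROVABLE elementary statements (targets); `GzeroAsymptotic` is a MEASURED enclosure (constant ×4 over the data) — a target
for the Level-2 analytic regime, not claimed proved.
-/

-- Port of theory seat `hubbard-h0-rotor-theory-1` cycle21/lean/PartN35.lean (sha16 e285266dfa591a47) verbatim modulo this header,
-- lint options, lint fixes and the gsymb/Gfun ↦ gres/Gres identification with PORT PartN37 (…Fibre3KernelWindow);
-- prover seat `hubbard-h0-rotor-p2` g0, `--supports stmt-HubbardSuperconductivity-19089`.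

set_option linter.dupNamespace false
noncomputable section

open scoped BigOperators
open Complex

namespace Summit.HubbardSuperconductivity.HubbardSuperconductivity.Theorems.AnisotropyChord.Transfer.Fibre3

variable (L : ℕ) [NeZero L]

/-! ## Objects -/

-- [port] the typed source declares `gsymb`/`Gfun` here; they have byte-identical bodies to PartN37's `gres`/`Gres`
-- (PartN37 header: «`gres`/`Gres` below coincide with PartN35's `gsymb`/`Gfun` (same formulas); on porting, identify them»),
-- so the single tree copy is PORT PartN37 (`…Fibre3KernelWindow`: `gres`, `Gres`) and every `gsymb`/`Gfun` of the typed source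
-- reads `gres`/`Gres` below.  Prop names are unchanged (`GfunZero` keeps its name).

/-- consistency with `Gzero` of the KT-1 layer: `G_λ(0) = Gzero λ` (port: `Gres L lam2 0 = Gzero L lam2`; typed name `GfunZero` kept). -/
def GfunZero : Prop := ∀ lam2 : ℝ, Gres L lam2 0 = Gzero L lam2

/-- `S₂(λ) = Σ_{k≠0} g(k)²`. -/
def S2sum (lam2 : ℝ) : ℝ := ∑ k : Tor L, gres L lam2 k ^ 2

/-! ## The profile in real space and the explicit `Δ(λ)` (gap equation solved for `Δ`) -/

/-- REAL-SPACE PROFILE FORMULA: off the origin `f(r) = 1 + Δ f(x̂)/V − c_s G_λ(r)`, `c_s = f(x̂)(4(1−Δ) + Δλ)`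
(Fourier inversion of `TwoMagnonFourier`; lib21 `chk_h` ≤ 1e-12). -/
def ProfileFromGreen (Δ : ℝ) : Prop :=
  ∀ lam2 : ℝ, ∀ f : Tor L → ℝ, IsTwoMagnon L Δ lam2 f → 0 < lam2 → lam2 < 2 * eps1 L →
    ∀ r : Tor L, r ≠ 0 → f r = 1 + Δ * f (K1 L) / (L : ℝ) ^ 2 - cS L Δ lam2 f * Gres L lam2 r

/-- `Δ` IS EXPLICIT IN `(λ, G_λ(0))`: from `1/f(x̂) = Δ(1 − 1/V) + (4(1−Δ) + Δλ) G_λ(0)` (`GreenZeroIdentity` ∘ sum rule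
`Vλ = 4(1−Δ) f(x̂)`), linear in `Δ`:  `Δ · (4/(Vλ) + 1 − 1/V − (4 − λ) G_λ(0)) = 4/(Vλ) − 4 G_λ(0)`.
(FIN parametrises cells by `λ`, not `Δ`.) -/
def DeltaExplicit (Δ : ℝ) : Prop :=
  ∀ lam2 : ℝ, ∀ f : Tor L → ℝ, IsTwoMagnon L Δ lam2 f → 0 < lam2 → lam2 < 2 * eps1 L →
    Δ * (4 / ((L : ℝ) ^ 2 * lam2) + 1 - 1 / (L : ℝ) ^ 2 - (4 - lam2) * Gzero L lam2)
      = 4 / ((L : ℝ) ^ 2 * lam2) - 4 * Gzero L lam2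

/-! ## Exact 1D row formulas (memo 21 §310(a)) -/

/-- RING RESOLVENT SUM (hyperbolic): for `μ > 0` and any `y`,
`Σ_{n ∈ ℤ_L} cos(2π n y/L)/(cosh μ − cos(2π n/L)) = L cosh((L/2 − y)μ)/(sinh μ · sinh(Lμ/2))` (`y` read through `val`;
the right side is symmetric under `y ↦ L − y`). Classical (1D lattice Green's function on a ring). -/
def RingResolventSum : Prop :=
  ∀ μ : ℝ, 0 < μ → ∀ y : ZMod L,
    (∑ n : ZMod L, Real.cos (2 * Real.pi * n.val * y.val / L) / (Real.cosh μ - Real.cos (2 * Real.pi * n.val / L)))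
      = L * Real.cosh (((L : ℝ) / 2 - y.val) * μ) / (Real.sinh μ * Real.sinh (L * μ / 2))

/-- RING RESOLVENT SUM (trigonometric continuation, the `m = 0` row): for `cos α ≠ cos(2πn/L)` (all `n`) and `sin(Lα/2) ≠ 0`,
`Σ_n cos(2π n y/L)/(cos α − cos(2π n/L)) = −L cos((L/2 − y)α)/(sin α · sin(Lα/2))`. -/
def RingResolventSumTrig : Prop :=
  ∀ α : ℝ, Real.sin α ≠ 0 → Real.sin (L * α / 2) ≠ 0 → (∀ n : ZMod L, Real.cos α ≠ Real.cos (2 * Real.pi * n.val / L)) →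
    ∀ y : ZMod L,
      (∑ n : ZMod L, Real.cos (2 * Real.pi * n.val * y.val / L) / (Real.cos α - Real.cos (2 * Real.pi * n.val / L)))
        = -(L * Real.cos (((L : ℝ) / 2 - y.val) * α) / (Real.sin α * Real.sin (L * α / 2)))

/-- row parameter `μ_m = arcosh(2 − cos(2πm/L) − λ/2)` (`m ≠ 0`). -/
def muRow (lam2 : ℝ) (m : ZMod L) : ℝ := Real.arcosh (2 - Real.cos (2 * Real.pi * m.val / L) - lam2 / 2)

/-- `α₀ = arccos(1 − λ/2)` (the `m = 0` row). -/
def alpha0 (lam2 : ℝ) : ℝ := Real.arccos (1 - lam2 / 2)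

/-- ROW FORMULA FOR `G_λ(x,y)` (O(L) closed form; gmin_row.py, 1e-15 against the 2D definition):
`V·G(x,y) = −L cos((L/2−y)α₀)/(2 sin α₀ sin(Lα₀/2)) + 1/(2(1 − cos α₀))
          + Σ_{m≠0} cos(2π m x/L) · L cosh((L/2−y)μ_m)/(2 sinh μ_m sinh(Lμ_m/2))`. -/
def GRowFormula : Prop :=
  ∀ lam2 : ℝ, 0 < lam2 → lam2 < 2 * eps1 L → ∀ r : Tor L,
    (L : ℝ) ^ 2 * Gres L lam2 r
      = -(L * Real.cos (((L : ℝ) / 2 - r.2.val) * alpha0 lam2)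
            / (2 * Real.sin (alpha0 lam2) * Real.sin (L * alpha0 lam2 / 2)))
        + 1 / (2 * (1 - Real.cos (alpha0 lam2)))
        + ∑ m ∈ (Finset.univ : Finset (ZMod L)).erase 0,
            Real.cos (2 * Real.pi * m.val * r.1.val / L)
              * (L * Real.cosh (((L : ℝ) / 2 - r.2.val) * muRow L lam2 m)
                  / (2 * Real.sinh (muRow L lam2 m) * Real.sinh (L * muRow L lam2 m / 2)))

/-! ## LEMMA G-MIN: `max_r(−G_λ(r))` bounded uniformly in `r` and `L` (memo 21 §312; enters `f_max = 1 + Δf(x̂)/V + c_s·max(−G)`) -/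

/-- HEAT-KERNEL BOUND: `g = ∫₀^∞ e^{−(2ε−λ)t}dt`, `G(r) = ∫₀^∞ e^{λt}(p_t(r) − 1/V)dt`, `p_t = e^{−tH₀}(0,r) ≥ 0`,
`|p_t(r) − 1/V| ≤ (1/V)Σ_{k≠0}e^{−2ε(k)t}`; hence for every `t₀ > 0` and every `r`:
`−G_λ(r) ≤ (e^{λt₀} − 1)/(λV) + (1/V) Σ_{k≠0} g(k) e^{−t₀/g(k)}` (t₀ = V/24: ≤ .0634 + .098ν vs truth .0553 + .083ν). -/
def HeatKernelGMin : Prop :=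
  ∀ lam2 : ℝ, 0 < lam2 → lam2 < 2 * eps1 L → ∀ t0 : ℝ, 0 < t0 → ∀ r : Tor L,
    -Gres L lam2 r
      ≤ (Real.exp (lam2 * t0) - 1) / (lam2 * (L : ℝ) ^ 2)
        + (∑ k ∈ (Finset.univ : Finset (Tor L)).erase 0,
            gres L lam2 k * Real.exp (-(t0 / gres L lam2 k))) / (L : ℝ) ^ 2

/-- GEOMETRIC (exponential-free) VARIANT: `2ε(k) − λ = 2(c₀ − b(k))`, `c₀ = 4 − λ/2`, `b(k) = 4 − ε(k) ∈ [0, 4 − ε₁]` the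
symbol of the entrywise-nonnegative matrix `B = 2·1 + A/2`; `G(r) = ½Σ_n c₀^{−n−1}[(Bⁿ)_{0r} − 4ⁿ/V]`, so for every `n₀`:
`−G_λ(r) ≤ ½ Σ_{n<n₀} 4ⁿ/(c₀^{n+1} V) + (1/V) Σ_{k≠0} (b(k)/c₀)^{n₀} g(k)`. -/
def GeomGMin : Prop :=
  ∀ lam2 : ℝ, 0 < lam2 → lam2 < 2 * eps1 L → ∀ n0 : ℕ, ∀ r : Tor L,
    -Gres L lam2 r
      ≤ (1 / 2 : ℝ) * (∑ n ∈ Finset.range n0, (4 : ℝ) ^ n / ((4 - lam2 / 2) ^ (n + 1) * (L : ℝ) ^ 2))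
        + (∑ k ∈ (Finset.univ : Finset (Tor L)).erase 0,
            ((4 - epsT L k) / (4 - lam2 / 2)) ^ n0 * gres L lam2 k) / (L : ℝ) ^ 2

/-! ## LEMMA L2-B1: the L-UNIFORM elementary bracket of `S₂` (memo 21 §311(b); template for every near-dominated sum) -/

/-- the integer window `{(m,n) : |m|,|n| ≤ K} ∖ {0}`. -/
def zWindow (K : ℕ) : Finset (ℤ × ℤ) :=
  ((Finset.Icc (-(K : ℤ)) K) ×ˢ (Finset.Icc (-(K : ℤ)) K)).erase (0, 0)

/-- lower window sum `Σ_{0<|m|∞≤K} 1/(|m|² − ν)²`. -/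
def xi2lo (ν : ℝ) (K : ℕ) : ℝ := ∑ p ∈ zWindow K, 1 / (((p.1 : ℝ) ^ 2 + (p.2 : ℝ) ^ 2) - ν) ^ 2

/-- upper window sum with the `θ₀`-Taylor factors, plus the `ℤ²` tail constant `(π⁵/16)/((K−1)² − νπ²/4)`. -/
def xi2hi (ν θ0 : ℝ) (K : ℕ) : ℝ :=
  (∑ p ∈ zWindow K,
      1 / (((p.1 : ℝ) ^ 2 * (1 - θ0 ^ 2 * (p.1 : ℝ) ^ 2 / 12) + (p.2 : ℝ) ^ 2 * (1 - θ0 ^ 2 * (p.2 : ℝ) ^ 2 / 12)) - ν) ^ 2)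
    + (Real.pi ^ 5 / 16) / (((K : ℝ) - 1) ^ 2 - ν * Real.pi ^ 2 / 4)

/-- LEMMA L2-B1 (S₂): for `L ≥ L₀ ≥ 8`, `4 ∣ L₀`, `K = L₀/4`, `θ₀ = 2π/L₀`, `0 ≤ ν < 4/π²`, `λ = ν(2π/L)²`:
`xi2lo ν K ≤ 16π⁴ S₂/L⁴ ≤ xi2hi ν θ₀ K` (ingredients: `x² − x⁴/12 ≤ 2(1−cos x) ≤ x²` on `|x| ≤ π/2`, `(4/π²)x² ≤ 2(1−cos x)`
on `|x| ≤ π`, `ℤ_L² ↪ (−L/2, L/2]²`, positivity, integral tail). Widths 8.0 / 1.9 / 0.5 % at L₀ = 32 / 64 / 128. -/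
def S2UniformBracket : Prop :=
  ∀ L0 : ℕ, 8 ≤ L0 → 4 ∣ L0 → L0 ≤ L → ∀ ν : ℝ, 0 ≤ ν → ν < 4 / Real.pi ^ 2 →
    xi2lo ν (L0 / 4) ≤ 16 * Real.pi ^ 4 * S2sum L (ν * (2 * Real.pi / L) ^ 2) / (L : ℝ) ^ 4 ∧
      16 * Real.pi ^ 4 * S2sum L (ν * (2 * Real.pi / L) ^ 2) / (L : ℝ) ^ 4 ≤ xi2hi ν (2 * Real.pi / L0) (L0 / 4)

/-! ## The asymptotic constant of `G_λ(0)` (family A; MEASURED enclosure, level2_g0.py) -/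

/-- `I₀ = ∫₀^π [1/√((1−cos k)(3−cos k)) − 1/k] dk = −0.1050091…`. -/
def I0const : ℝ := ∫ k in (0 : ℝ)..Real.pi, (1 / Real.sqrt ((1 - Real.cos k) * (3 - Real.cos k)) - 1 / k)

/-- `c(ν) = (1/4π²)Σ_{n∈ℤ∖0} 1/(n²−ν) + (1/2π)[γ − ln 2 + Σ_{m≥1}(1/√(m²−ν) − 1/m) + I₀] + (1/π)Σ_{m≥1} 1/(√(m²−ν)(e^{2π√(m²−ν)} − 1))`;
`c(0) = 0.0487656` (the classical torus constant), `c(.02) = .0518669`, `c(.04) = .0550681`, `c(.07) = .0600701`. -/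
def cNu (ν : ℝ) : ℝ :=
  (∑' m : ℕ, 2 / (((m : ℝ) + 1) ^ 2 - ν)) / (4 * Real.pi ^ 2)
    + (Real.eulerMascheroniConstant - Real.log 2
        + (∑' m : ℕ, (1 / Real.sqrt (((m : ℝ) + 1) ^ 2 - ν) - 1 / ((m : ℝ) + 1))) + I0const) / (2 * Real.pi)
    + (∑' m : ℕ, 1 / (Real.sqrt (((m : ℝ) + 1) ^ 2 - ν)
        * (Real.exp (2 * Real.pi * Real.sqrt (((m : ℝ) + 1) ^ 2 - ν)) - 1))) / Real.pi

/-- MEASURED ASYMPTOTIC ENCLOSURE (target; data 8 ≤ L ≤ 4096, 0 ≤ ν ≤ .07 show |E| ≤ (.03 + 1.1ν ln L)/L²; stated ×4):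
`|G_λ(0) − ln L/(2π) − c(ν)| ≤ (0.2 + 4.4 ν ln L)/L²` for `λ = ν(2π/L)²`. Rigorous route: 1D row formula + m₀ = 3 explicit rows
+ convexity brackets + closed-form primitives (memo 21 §311(b) A). Downstream precision needed: ±.01. -/
def GzeroAsymptotic : Prop :=
  8 ≤ L → ∀ ν : ℝ, 0 ≤ ν → ν ≤ 0.07 →
    |Gzero L (ν * (2 * Real.pi / L) ^ 2) - Real.log L / (2 * Real.pi) - cNu ν|
      ≤ (0.2 + 4.4 * ν * Real.log L) / (L : ℝ) ^ 2

end Summit.HubbardSuperconductivity.HubbardSuperconductivity.Theorems.AnisotropyChord.Transfer.Fibre3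

end
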